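import Summits.QuantumFields.GaugeBoot.StrongCouplingThirdOrderPieces
import HarnessLib

/-!
# Strong coupling from the loop equation: the READ-MANY bound — `k` separated once-read links give `O(β^k)` (gauge-boot, ADDENDUM 26 part A)

HONEST FRAMING (cell `pub-gaugeboot`, page 1 of every file): the venture produces certified bounds
on lattice expectations at stated coupling, gauge group, dimension and torus size; NOT a mass gap,
NOT a continuum limit, NOT a string tension; NOT Yang–Mills-summit-bearing (barriers
`FixedCouplingUltralocality`, `PerturbativeInvisibility`).  A crude explicit ALL-ORDER strong-coupling bound, valid on
every torus `(ℤ/L)^d` and at every real coupling; it certifies no number of the cell's tables; NOT an area law.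

## Content (`SU(N)`, `N ≥ 2`, fundamental representation, tree coupling `β`)

The read-once bound of ADDENDUM 24 (`StrongCouplingReadOnce`): a closed word reading some link exactly once, times a
multiplier ignoring that link, has expectation `≤ 4(d−1)N²M|β|/(N²−1)`.  This file ITERATES it.  Two links are
SEPARATED when no plaquette through the first contains the second (`Separated`).  If a closed word `W` reads each of
`k` pairwise separated links `e₁, …, e_k` exactly once and the continuous multiplier `g` (`‖g‖ ≤ M`) ignores all of
them, then one multiplier loop-equation step at `e₁` (`coeff_mul_integral_trace_mul_eq`) produces only terms of the
same kind for `e₂, …, e_k`: the deformed words `W·P̃^{±1}` (`P̃` a plaquette word through `e₁` reads none of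
`e₂, …, e_k`) and the double-trace terms `tr hol W · (tr hol P̃^{±1} · g)`, whose plaquette trace joins the multiplier.
Induction on `k`: `exists_rotation_of_count_eq_one` (the rotation bookkeeping of the read-once bound, packaged),
`integral_plaqTerm_mul_suN` (the plaquette term times a multiplier, integrated), and
★★★ `norm_integral_trace_mul_suN_le_of_separated` — **`‖E[tr hol_z W · g]‖ ≤ N·M·(4(d−1)N|β|/(N²−1))^k`** for every
`L`, every real `β`;  ★★ `norm_integral_trace_suN_le_of_separated` (`g = 1`): **`‖E[tr hol_z W]‖ ≤ N·a^k`**,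
`a = 4(d−1)N|β|/(N²−1)` (`= 4(d−1)|β_std|/(N²−1)` in the standard coupling `β_std = Nβ`).  The rectangles
(`2(R+T) − 4` separated boundary links; `T` for the `1 × T` loop) are in `StrongCouplingWilsonLoopDecay`.

References: Yu. Makeenko, *Methods of contemporary gauge theory* (2002) Problem 12.7 (iterating the loop equation at
strong coupling); I. Montvay, G. Münster, *Quantum fields on a lattice* (1994) §3.4.5.  Everything is `[folklore]`.
-/

noncomputable section

open MeasureTheory Filter Topology NormedSpace
open scoped Matrix.Norms.Frobenius Matrix
open Literature.MathematicalPhysics.QuantumFieldTheory Literature.MathematicalPhysics.QuantumLattice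
open Summit.QuantumFields.YangMills.Cruxes.CurvatureAmnesia.WardDefect.SchwingerDyson

namespace Summit.QuantumFields.GaugeBoot

namespace StrongCoupling

variable {d L N : ℕ}

/-! ## Separated links and the plaquette words -/

section Separated

/-- The link `e'` lies on NO plaquette through the link `e`: no plaquette word `P̃_{ν,ε} = plaqWord e.2 ν ε` (`ν ≠ e.2`)
read from the source `e.1` of `e` reads `e'`. [folklore] -/
def Separated (e e' : Edge d L) : Prop :=
  ∀ ν : Fin d, ν ≠ e.2 → ∀ ε : Bool, e' ∉ Word.edgesRead e.1 (plaqWord e.2 ν ε)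

/-- `P̃⁻¹` reads the same links as `P̃`. [folklore] -/
theorem mem_edgesRead_plaqWord_reverse_iff (x : Site d L) (μ ν : Fin d) (ε : Bool) (e' : Edge d L) :
    e' ∈ Word.edgesRead x (plaqWord μ ν ε).reverse ↔ e' ∈ Word.edgesRead x (plaqWord μ ν ε) := by
  cases ε with
  | true =>
    rw [edgesRead_plaqWord_true, edgesRead_plaqWord_true_reverse]
    simp only [List.mem_cons, List.mem_nil_iff, or_false]
    tauto
  | false =>
    rw [edgesRead_plaqWord_false, edgesRead_plaqWord_false_reverse]
    simp only [List.mem_cons, List.mem_nil_iff, or_false]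
    tauto

/-- A separated link is read by neither `P̃` nor `P̃⁻¹`. [folklore] -/
theorem Separated.not_mem {e e' : Edge d L} (h : Separated e e') {ν : Fin d} (hν : ν ≠ e.2) (ε : Bool) {q : Word d}
    (hq : q = plaqWord e.2 ν ε ∨ q = (plaqWord e.2 ν ε).reverse) : e' ∉ Word.edgesRead e.1 q := by
  rcases hq with rfl | rfl
  · exact h ν hν ε
  · rw [mem_edgesRead_plaqWord_reverse_iff]; exact h ν hν ε

/-- Appending `P̃^{±1}` at a link separated from `e'` does not change the count of `e'`. [folklore] -/
theorem count_edgesRead_append_qw {e e' : Edge d L} (h : Separated e e') {ν : Fin d} (hν : ν ≠ e.2) (ε : Bool)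
    {q : Word d} (hq : q = plaqWord e.2 ν ε ∨ q = (plaqWord e.2 ν ε).reverse) {R : Word d}
    (hR : Word.endpoint e.1 R = e.1) :
    (Word.edgesRead e.1 (R ++ q)).count e' = (Word.edgesRead e.1 R).count e' := by
  rw [Word.edgesRead_append, hR, List.count_append, List.count_eq_zero_of_not_mem (h.not_mem hν ε hq), add_zero]

end Separated

/-! ## Rotation: a once-read link can be taken as the marked first/last letter -/

section Rotation

variable {G : Type} [Group G] {ρ : G →* Matrix (Fin N) (Fin N) ℂ}

/-- Counts of edges are invariant under rotation of a closed word. [folklore] -/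
theorem count_edgesRead_rotate (z : Site d L) (u v : Word d) (hv : Word.endpoint (Word.endpoint z u) v = z)
    (e' : Edge d L) :
    (Word.edgesRead (Word.endpoint z u) (v ++ u)).count e' = (Word.edgesRead z (u ++ v)).count e' := by
  rw [Word.edgesRead_append, Word.edgesRead_append, hv, List.count_append, List.count_append, add_comm]

variable (ρ) in
/-- ★ **Rotation data of a once-read link.**  Let `W` be closed at `z` and read `e` exactly once.  Then there is a word
`R` closed at the source `e.1` of `e` with the same trace of holonomy (pointwise), the same edge counts, and whose split
sum at `(e.1, e.2)` is `c·tr ρ(hol R)` with `c = ±(N − s/N)` (`+`: `e` read forward, rotated first; `−`: backward,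
rotated last). [folklore] -/
theorem exists_rotation_of_count_eq_one (s : ℂ) (z : Site d L) (W : Word d) (hW : Word.endpoint z W = z)
    (e : Edge d L) (hcount : (Word.edgesRead z W).count e = 1) :
    ∃ R : Word d, Word.endpoint e.1 R = e.1 ∧
      (∀ U : GaugeConfig d L G, (ρ (wordHolonomy U z W)).trace = (ρ (wordHolonomy U e.1 R)).trace) ∧
      (∀ e' : Edge d L, (Word.edgesRead e.1 R).count e' = (Word.edgesRead z W).count e') ∧
      ∃ c : ℂ, (c = (N : ℂ) - s / N ∨ c = -((N : ℂ) - s / N)) ∧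
        ∀ U : GaugeConfig d L G, ∑ k ∈ Finset.range R.length, splitTerm ρ s e.1 e.2 U R k =
          c * (ρ (wordHolonomy U e.1 R)).trace := by
  obtain S := Word.split z W e hcount
  set p : Site d L := Word.endpoint z S.pre with hp
  have hback : Word.endpoint p (S.step :: S.suf) = z := by
    have h := hW
    rw [S.eq, Word.endpoint_append] at h
    exact h
  have hsuf : Word.endpoint (S.step.apply p) S.suf = z := by simpa using hback
  obtain ⟨step, hstep⟩ : ∃ st, S.step = st := ⟨_, rfl⟩
  cases step with
  | fwd κ =>
    have he : e = (p, κ) := by rw [← S.step_edge, hstep, Step.edge_fwd]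
    have he1 : e.1 = p := by rw [he]
    have he2 : e.2 = κ := by rw [he]
    rw [he1, he2]
    refine ⟨(Step.fwd κ :: S.suf) ++ S.pre, ?_, fun U => ?_, fun e' => ?_, (N : ℂ) - s / N, Or.inl rfl, fun U => ?_⟩
    · rw [Word.endpoint_append, ← hstep, hback]
    · have h := trace_wordHolonomy_append_comm (ρ := ρ) U z S.pre (S.step :: S.suf) hback
      rw [← S.eq, hstep] at h
      exact h
    · have h := count_edgesRead_rotate z S.pre (S.step :: S.suf) hback e'
      rw [← S.eq, hstep] at h
      exact h
    · have htail : (p, κ) ∉ Word.edgesRead (p.shift κ) (S.suf ++ S.pre) := by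
        rw [Word.edgesRead_append]
        have h1 : (p, κ) ∉ Word.edgesRead (p.shift κ) S.suf := fun hmem => by
          have h := S.suf_not_mem
          rw [hstep, Step.apply_fwd] at h
          rw [← he] at hmem
          exact h hmem
        have h2 : Word.endpoint (p.shift κ) S.suf = z := by rwa [hstep, Step.apply_fwd] at hsuf
        rw [h2]
        exact List.not_mem_append h1 (fun hmem => S.pre_not_mem (by rw [← he] at hmem; exact hmem))
      rw [List.cons_append]
      exact sum_splitTerm_cons_fwd_of_not_mem s p κ U htail
  | bwd κ =>
    set z' : Site d L := p - Pi.single κ 1 with hz'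
    have he : e = (z', κ) := by rw [← S.step_edge, hstep, Step.edge_bwd]
    have he1 : e.1 = z' := by rw [he]
    have he2 : e.2 = κ := by rw [he]
    rw [he1, he2]
    have happ : (Step.bwd κ).apply p = z' := by rw [Step.apply_bwd]
    have hpre' : Word.endpoint z (S.pre ++ [Step.bwd κ]) = z' := by
      rw [Word.endpoint_append, ← hp, Word.endpoint_cons, Word.endpoint_nil, happ]
    have hsuf' : Word.endpoint z' S.suf = z := by rwa [hstep, happ] at hsuf
    have hWeq : W = (S.pre ++ [Step.bwd κ]) ++ S.suf :=
      calc W = S.pre ++ S.step :: S.suf := S.eq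
        _ = (S.pre ++ [Step.bwd κ]) ++ S.suf := by rw [hstep, List.append_assoc]; rfl
    refine ⟨S.suf ++ (S.pre ++ [Step.bwd κ]), ?_, fun U => ?_, fun e' => ?_, -((N : ℂ) - s / N), Or.inr rfl, fun U => ?_⟩
    · rw [Word.endpoint_append, hsuf', hpre']
    · have h := trace_wordHolonomy_append_comm (ρ := ρ) U z (S.pre ++ [Step.bwd κ]) S.suf (by rw [hpre', hsuf'])
      rw [← hWeq, hpre'] at h
      exact h
    · have h := count_edgesRead_rotate z (S.pre ++ [Step.bwd κ]) S.suf (by rw [hpre', hsuf']) e'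
      rw [← hWeq, hpre'] at h
      exact h
    · have hR' : S.suf ++ (S.pre ++ [Step.bwd κ]) = (S.suf ++ S.pre) ++ [Step.bwd κ] := by rw [List.append_assoc]
      have hvend : Word.endpoint z' (S.suf ++ S.pre) = z'.shift κ := by
        rw [Word.endpoint_append, hsuf', ← hp, hz', Site.shift, sub_add_cancel]
      have htail : Word.Avoids z' (S.suf ++ S.pre) (z', κ) := by
        refine Word.avoids_of_not_mem_edgesRead ?_
        rw [Word.edgesRead_append, hsuf']
        have h1 : (z', κ) ∉ Word.edgesRead z' S.suf := fun hmem => by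
          have h := S.suf_not_mem
          rw [hstep, happ] at h
          rw [← he] at hmem
          exact h hmem
        exact List.not_mem_append h1 (fun hmem => S.pre_not_mem (by rw [← he] at hmem; exact hmem))
      rw [hR', sum_splitTerm_snoc_bwd ρ s z' κ U htail hvend]
      ring

end Rotation

/-! ## The plaquette term times a multiplier, integrated -/

section PlaqTerm

variable [NeZero L]

/-- **`∫ plaqTerm_{ν,ε}(R)·g = E[tr hol(R·P̃)·g] − E[tr hol(R·P̃⁻¹)·g] − (1/N)(E[tr hol R · (tr hol P̃ · g)] −
E[tr hol R · (tr hol P̃⁻¹ · g)])`** (`SU(N)`, continuous `g`). [folklore] -/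
theorem integral_plaqTerm_mul_suN (β : ℝ) (p : Site d L) (κ : Fin d) (R : Word d)
    {g : GaugeConfig d L (Matrix.specialUnitaryGroup (Fin N) ℂ) → ℂ} (hg : Continuous g) (ν : Fin d) (ε : Bool) :
    ∫ U, plaqTerm (fundamentalRep (Fin N)) 1 p κ U R ν ε * g U ∂(wilsonMeasure (d := d) (L := L) (fundamentalRep (Fin N)) β) =
      (∫ U, (fundamentalRep (Fin N) (wordHolonomy U p (R ++ plaqWord κ ν ε))).trace * g U
          ∂(wilsonMeasure (d := d) (L := L) (fundamentalRep (Fin N)) β)) -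
        (∫ U, (fundamentalRep (Fin N) (wordHolonomy U p (R ++ (plaqWord κ ν ε).reverse))).trace * g U
          ∂(wilsonMeasure (d := d) (L := L) (fundamentalRep (Fin N)) β)) -
        1 / (N : ℂ) * ((∫ U, (fundamentalRep (Fin N) (wordHolonomy U p R)).trace *
            ((fundamentalRep (Fin N) (wordHolonomy U p (plaqWord κ ν ε))).trace * g U)
              ∂(wilsonMeasure (d := d) (L := L) (fundamentalRep (Fin N)) β)) -
          (∫ U, (fundamentalRep (Fin N) (wordHolonomy U p R)).trace *
            ((fundamentalRep (Fin N) (wordHolonomy U p (plaqWord κ ν ε).reverse)).trace * g U)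
              ∂(wilsonMeasure (d := d) (L := L) (fundamentalRep (Fin N)) β))) := by
  have hc : ∀ (y : Site d L) (u : Word d), Continuous fun U : GaugeConfig d L (Matrix.specialUnitaryGroup (Fin N) ℂ) =>
      (fundamentalRep (Fin N) (wordHolonomy U y u)).trace :=
    fun y u => continuous_trace_wordHolonomy (fundamentalLatticeRep N) y u
  have hA : Integrable (fun U : GaugeConfig d L (Matrix.specialUnitaryGroup (Fin N) ℂ) =>
      (fundamentalRep (Fin N) (wordHolonomy U p (R ++ plaqWord κ ν ε))).trace * g U)
      (wilsonMeasure (d := d) (L := L) (fundamentalRep (Fin N)) β) :=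
    integrable_of_continuous (fundamentalLatticeRep N) β ((hc p _).mul hg)
  have hB : Integrable (fun U : GaugeConfig d L (Matrix.specialUnitaryGroup (Fin N) ℂ) =>
      (fundamentalRep (Fin N) (wordHolonomy U p (R ++ (plaqWord κ ν ε).reverse))).trace * g U)
      (wilsonMeasure (d := d) (L := L) (fundamentalRep (Fin N)) β) :=
    integrable_of_continuous (fundamentalLatticeRep N) β ((hc p _).mul hg)
  have hC : Integrable (fun U : GaugeConfig d L (Matrix.specialUnitaryGroup (Fin N) ℂ) =>
      1 / (N : ℂ) * ((fundamentalRep (Fin N) (wordHolonomy U p R)).trace *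
        ((fundamentalRep (Fin N) (wordHolonomy U p (plaqWord κ ν ε))).trace * g U)))
      (wilsonMeasure (d := d) (L := L) (fundamentalRep (Fin N)) β) :=
    integrable_of_continuous (fundamentalLatticeRep N) β (continuous_const.mul ((hc p R).mul ((hc p _).mul hg)))
  have hD : Integrable (fun U : GaugeConfig d L (Matrix.specialUnitaryGroup (Fin N) ℂ) =>
      1 / (N : ℂ) * ((fundamentalRep (Fin N) (wordHolonomy U p R)).trace *
        ((fundamentalRep (Fin N) (wordHolonomy U p (plaqWord κ ν ε).reverse)).trace * g U)))
      (wilsonMeasure (d := d) (L := L) (fundamentalRep (Fin N)) β) :=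
    integrable_of_continuous (fundamentalLatticeRep N) β (continuous_const.mul ((hc p R).mul ((hc p _).mul hg)))
  have hpt : ∀ U : GaugeConfig d L (Matrix.specialUnitaryGroup (Fin N) ℂ),
      plaqTerm (fundamentalRep (Fin N)) 1 p κ U R ν ε * g U =
      ((fundamentalRep (Fin N) (wordHolonomy U p (R ++ plaqWord κ ν ε))).trace * g U -
        (fundamentalRep (Fin N) (wordHolonomy U p (R ++ (plaqWord κ ν ε).reverse))).trace * g U) -
      (1 / (N : ℂ) * ((fundamentalRep (Fin N) (wordHolonomy U p R)).trace *
          ((fundamentalRep (Fin N) (wordHolonomy U p (plaqWord κ ν ε))).trace * g U)) -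
        1 / (N : ℂ) * ((fundamentalRep (Fin N) (wordHolonomy U p R)).trace *
          ((fundamentalRep (Fin N) (wordHolonomy U p (plaqWord κ ν ε).reverse)).trace * g U))) := fun U => by
    simp only [plaqTerm]; ring
  have hAB : Integrable (fun U : GaugeConfig d L (Matrix.specialUnitaryGroup (Fin N) ℂ) =>
      (fundamentalRep (Fin N) (wordHolonomy U p (R ++ plaqWord κ ν ε))).trace * g U -
        (fundamentalRep (Fin N) (wordHolonomy U p (R ++ (plaqWord κ ν ε).reverse))).trace * g U)
      (wilsonMeasure (d := d) (L := L) (fundamentalRep (Fin N)) β) := hA.sub hB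
  have hCD : Integrable (fun U : GaugeConfig d L (Matrix.specialUnitaryGroup (Fin N) ℂ) =>
      1 / (N : ℂ) * ((fundamentalRep (Fin N) (wordHolonomy U p R)).trace *
          ((fundamentalRep (Fin N) (wordHolonomy U p (plaqWord κ ν ε))).trace * g U)) -
        1 / (N : ℂ) * ((fundamentalRep (Fin N) (wordHolonomy U p R)).trace *
          ((fundamentalRep (Fin N) (wordHolonomy U p (plaqWord κ ν ε).reverse)).trace * g U)))
      (wilsonMeasure (d := d) (L := L) (fundamentalRep (Fin N)) β) := hC.sub hD
  simp_rw [hpt]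
  rw [integral_sub hAB hCD, integral_sub hA hB, integral_sub hC hD, integral_const_mul, integral_const_mul, mul_sub]

end PlaqTerm

/-! ## The read-many bound -/

section ReadMany

variable [NeZero L]

omit [NeZero L] in
/-- From `c·z = −(β/2)·S` with `‖c‖ = c₀ > 0` and `‖S‖ ≤ B`: `‖z‖ ≤ (|β|/2)·B/c₀`. [folklore] -/
theorem norm_le_of_coeff_mul_eq' {c z S : ℂ} {c₀ β B : ℝ} (hc : ‖c‖ = c₀) (hc₀ : 0 < c₀)
    (h : c * z = -((β / 2 : ℂ) * S)) (hS : ‖S‖ ≤ B) : ‖z‖ ≤ |β| / 2 * B / c₀ := by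
  have hn := congrArg (fun z : ℂ => ‖z‖) h
  simp only [norm_mul, norm_neg, hc, norm_half_ofReal] at hn
  rw [le_div_iff₀ hc₀, mul_comm ‖z‖, hn]
  exact mul_le_mul_of_nonneg_left hS (by positivity)

omit [NeZero L] in
/-- `‖±(N − 1/N)‖ = (N² − 1)/N` for `N ≥ 2`. [folklore] -/
theorem norm_coeff_eq (hN : 2 ≤ N) {c : ℂ} (hc : c = (N : ℂ) - 1 / N ∨ c = -((N : ℂ) - 1 / N)) :
    ‖c‖ = ((N : ℝ) ^ 2 - 1) / N := by
  have hpos := coeff_pos hN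
  rcases hc with rfl | rfl
  · rw [coeff_cast hN, Complex.norm_real, Real.norm_eq_abs, abs_of_pos hpos]
  · rw [norm_neg, coeff_cast hN, Complex.norm_real, Real.norm_eq_abs, abs_of_pos hpos]

/-- The base case: `‖E[tr hol W · g]‖ ≤ N·M`. [folklore] -/
theorem norm_integral_trace_mul_suN_le_base (β : ℝ) (z : Site d L) (W : Word d)
    {g : GaugeConfig d L (Matrix.specialUnitaryGroup (Fin N) ℂ) → ℂ} {M : ℝ} (hM : ∀ U, ‖g U‖ ≤ M) :
    ‖∫ U, (fundamentalRep (Fin N) (wordHolonomy U z W)).trace * g U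
        ∂(wilsonMeasure (d := d) (L := L) (fundamentalRep (Fin N)) β)‖ ≤ N * M := by
  haveI := isProbabilityMeasure_wilsonMeasure (d := d) (L := L) (fundamentalRep (Fin N)) (fundamentalLatticeRep N).continuous β
  have hpt : ∀ U : GaugeConfig d L (Matrix.specialUnitaryGroup (Fin N) ℂ),
      ‖(fundamentalRep (Fin N) (wordHolonomy U z W)).trace * g U‖ ≤ N * M := fun U => by
    rw [norm_mul]
    have h : ‖(fundamentalRep (Fin N) (wordHolonomy U z W)).trace‖ ≤ (N : ℝ) :=
      norm_trace_le (fundamentalLatticeRep N) (wordHolonomy U z W)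
    exact mul_le_mul h (hM U) (norm_nonneg _) (Nat.cast_nonneg N)
  have h := norm_integral_le_of_norm_le_const (μ := wilsonMeasure (d := d) (L := L) (fundamentalRep (Fin N)) β)
    (ae_of_all _ hpt)
  rwa [probReal_univ, mul_one] at h

/-- ★★★ **THE READ-MANY BOUND, `SU(N)`** (`N ≥ 2`, fundamental representation, tree coupling `β`).  Let the word `W` be
closed at `z` and read EACH link of the list `F` EXACTLY ONCE, the links of `F` being pairwise SEPARATED (no plaquette
through one contains a later one), and let the continuous multiplier `g` ignore every link of `F`, `‖g‖ ≤ M`.  Then on every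
torus `(ℤ/L)^d` and for every real `β`:
`‖E[tr hol_z W · g]‖ ≤ N·M·(4(d−1)N|β|/(N²−1))^{|F|}`. [folklore] -/
theorem norm_integral_trace_mul_suN_le_of_separated (hN : 2 ≤ N) (β : ℝ) :
    ∀ (F : List (Edge d L)) (z : Site d L) (W : Word d) (_ : Word.endpoint z W = z)
      (_ : ∀ e ∈ F, (Word.edgesRead z W).count e = 1) (_ : F.Pairwise Separated)
      (g : GaugeConfig d L (Matrix.specialUnitaryGroup (Fin N) ℂ) → ℂ) (M : ℝ) (_ : Continuous g)
      (_ : ∀ e ∈ F, ∀ (U : GaugeConfig d L (Matrix.specialUnitaryGroup (Fin N) ℂ)) (h : Matrix.specialUnitaryGroup (Fin N) ℂ),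
        g (Function.update U e h) = g U)
      (_ : ∀ U, ‖g U‖ ≤ M),
      ‖∫ U, (fundamentalRep (Fin N) (wordHolonomy U z W)).trace * g U
          ∂(wilsonMeasure (d := d) (L := L) (fundamentalRep (Fin N)) β)‖ ≤
        N * M * (4 * ((d : ℝ) - 1) * N * |β| / ((N : ℝ) ^ 2 - 1)) ^ F.length
  | [], z, W, _, _, _, g, M, _, _, hM => by
    rw [List.length_nil, pow_zero, mul_one]
    exact norm_integral_trace_mul_suN_le_base β z W hM
  | e :: F, z, W, hW, hcount, hsep, g, M, hg, hge, hM => by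
    obtain ⟨a, ha⟩ : ∃ a : ℝ, a = 4 * ((d : ℝ) - 1) * N * |β| / ((N : ℝ) ^ 2 - 1) := ⟨_, rfl⟩
    rw [← ha]
    have hN2 : (2 : ℝ) ≤ N := by exact_mod_cast hN
    have hN21 : (0 : ℝ) < (N : ℝ) ^ 2 - 1 := by nlinarith
    obtain ⟨hsep₁, hsep₂⟩ := List.pairwise_cons.1 hsep
    have hcount₂ : ∀ e' ∈ F, (Word.edgesRead z W).count e' = 1 := fun e' he' => hcount e' (List.mem_cons_of_mem _ he')
    have hge₁ : ∀ (U : GaugeConfig d L (Matrix.specialUnitaryGroup (Fin N) ℂ)) (h : Matrix.specialUnitaryGroup (Fin N) ℂ),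
        g (Function.update U (e.1, e.2) h) = g U := fun U h => hge e List.mem_cons_self U h
    have hge₂ : ∀ e' ∈ F, ∀ (U : GaugeConfig d L (Matrix.specialUnitaryGroup (Fin N) ℂ)) (h : Matrix.specialUnitaryGroup (Fin N) ℂ),
        g (Function.update U e' h) = g U := fun e' he' => hge e' (List.mem_cons_of_mem _ he')
    -- rotate so that `e` is the marked first/last letter
    obtain ⟨R, hRcl, hrot, hRcount, c, hc, hsplit⟩ :=
      exists_rotation_of_count_eq_one (fundamentalRep (Fin N)) 1 z W hW e (hcount e List.mem_cons_self)
    have hRcount₂ : ∀ e' ∈ F, (Word.edgesRead e.1 R).count e' = 1 := fun e' he' => by rw [hRcount]; exact hcount₂ e' he'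
    -- the induction hypothesis for the four kinds of terms
    have hA : ∀ {ν : Fin d} (_ : ν ≠ e.2) (ε : Bool) {q : Word d} (_ : q = plaqWord e.2 ν ε ∨ q = (plaqWord e.2 ν ε).reverse),
        ‖∫ U, (fundamentalRep (Fin N) (wordHolonomy U e.1 (R ++ q))).trace * g U
            ∂(wilsonMeasure (d := d) (L := L) (fundamentalRep (Fin N)) β)‖ ≤ N * M * a ^ F.length :=
      fun {ν} hν ε {q} hq => by
        rw [ha]
        exact norm_integral_trace_mul_suN_le_of_separated hN β F e.1 (R ++ q)
          (by rw [Word.endpoint_append, hRcl]; exact endpoint_qw e.1 ε hq)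
          (fun e' he' => by rw [count_edgesRead_append_qw (hsep₁ e' he') hν ε hq hRcl]; exact hRcount₂ e' he')
          hsep₂ g M hg hge₂ hM
    have hB : ∀ {ν : Fin d} (_ : ν ≠ e.2) (ε : Bool) {q : Word d} (_ : q = plaqWord e.2 ν ε ∨ q = (plaqWord e.2 ν ε).reverse),
        ‖∫ U, (fundamentalRep (Fin N) (wordHolonomy U e.1 R)).trace *
            ((fundamentalRep (Fin N) (wordHolonomy U e.1 q)).trace * g U)
            ∂(wilsonMeasure (d := d) (L := L) (fundamentalRep (Fin N)) β)‖ ≤ N * (N * M) * a ^ F.length :=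
      fun {ν} hν ε {q} hq => by
        rw [ha]
        exact norm_integral_trace_mul_suN_le_of_separated hN β F e.1 R hRcl hRcount₂ hsep₂
          (fun U => (fundamentalRep (Fin N) (wordHolonomy U e.1 q)).trace * g U) (N * M)
          ((continuous_trace_wordHolonomy (fundamentalLatticeRep N) e.1 q).mul hg)
          (fun e' he' U h => by
            rw [wordHolonomy_update_of_not_mem U e' h e.1 q ((hsep₁ e' he').not_mem hν ε hq), hge₂ e' he' U h])
          (fun U => by
            rw [norm_mul]
            have h : ‖(fundamentalRep (Fin N) (wordHolonomy U e.1 q)).trace‖ ≤ (N : ℝ) :=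
              norm_trace_le (fundamentalLatticeRep N) (wordHolonomy U e.1 q)
            exact mul_le_mul h (hM U) (norm_nonneg _) (Nat.cast_nonneg N))
    -- the loop equation of `R` at `e` with the multiplier `g`
    have heq := coeff_mul_integral_trace_mul_eq (d := d) (L := L) (fundamentalLatticeRep N) β e.1 e.2 1 c R hRcl hsplit hg
      (fun i j => sdPairMul_specialUnitaryGroup N β e.1 e.2 e.1 R hg hge₁ _ (trace_unitDir_one i j))
    simp only [fundamentalLatticeRep_N, fundamentalLatticeRep_ρ] at heq
    simp only [integral_plaqTerm_mul_suN β e.1 e.2 R hg] at heq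
    -- every term is bounded by the induction hypothesis
    have hterm : ∀ ν ∈ Finset.univ.erase e.2, ∀ ε : Bool,
        ‖(∫ U, (fundamentalRep (Fin N) (wordHolonomy U e.1 (R ++ plaqWord e.2 ν ε))).trace * g U
            ∂(wilsonMeasure (d := d) (L := L) (fundamentalRep (Fin N)) β)) -
          (∫ U, (fundamentalRep (Fin N) (wordHolonomy U e.1 (R ++ (plaqWord e.2 ν ε).reverse))).trace * g U
            ∂(wilsonMeasure (d := d) (L := L) (fundamentalRep (Fin N)) β)) -
          1 / (N : ℂ) * ((∫ U, (fundamentalRep (Fin N) (wordHolonomy U e.1 R)).trace *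
              ((fundamentalRep (Fin N) (wordHolonomy U e.1 (plaqWord e.2 ν ε))).trace * g U)
                ∂(wilsonMeasure (d := d) (L := L) (fundamentalRep (Fin N)) β)) -
            (∫ U, (fundamentalRep (Fin N) (wordHolonomy U e.1 R)).trace *
              ((fundamentalRep (Fin N) (wordHolonomy U e.1 (plaqWord e.2 ν ε).reverse)).trace * g U)
                ∂(wilsonMeasure (d := d) (L := L) (fundamentalRep (Fin N)) β)))‖ ≤
          2 * (N * M * a ^ F.length) + 1 / N * (2 * (N * (N * M) * a ^ F.length)) := by
      intro ν hν ε
      have hνe : ν ≠ e.2 := (Finset.mem_erase.1 hν).1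
      exact norm_four_piece_le (hA hνe ε (Or.inl rfl)) (hA hνe ε (Or.inr rfl)) (hB hνe ε (Or.inl rfl)) (hB hνe ε (Or.inr rfl))
    have hS := norm_sum_sum_le_of_le hterm
    have h4 : 2 * (N * M * a ^ F.length) + 1 / N * (2 * (N * (N * M) * a ^ F.length)) = 4 * (N * M * a ^ F.length) := by
      field_simp
      ring
    rw [h4] at hS
    have hmain := norm_le_of_coeff_mul_eq' (norm_coeff_eq hN hc) (coeff_pos hN) heq hS
    simp_rw [hrot]
    refine hmain.trans (le_of_eq ?_)
    rw [List.length_cons, pow_succ]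
    have key : ∀ P : ℝ, |β| / 2 * (((d : ℝ) - 1) * (2 * (4 * (N * M * P)))) / (((N : ℝ) ^ 2 - 1) / N) =
        N * M * (P * a) := fun P => by
      rw [ha]
      field_simp
    exact key _

/-- ★★ **THE READ-MANY BOUND WITHOUT MULTIPLIER**: a closed word reading each of `k` pairwise separated links exactly once
has `‖E[tr hol_z W]‖ ≤ N·(4(d−1)N|β|/(N²−1))^k` on every torus, at every real `β`. [folklore] -/
theorem norm_integral_trace_suN_le_of_separated (hN : 2 ≤ N) (β : ℝ) (F : List (Edge d L)) (z : Site d L) (W : Word d)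
    (hW : Word.endpoint z W = z) (hcount : ∀ e ∈ F, (Word.edgesRead z W).count e = 1) (hsep : F.Pairwise Separated) :
    ‖∫ U, (fundamentalRep (Fin N) (wordHolonomy U z W)).trace ∂(wilsonMeasure (d := d) (L := L) (fundamentalRep (Fin N)) β)‖ ≤
      N * (4 * ((d : ℝ) - 1) * N * |β| / ((N : ℝ) ^ 2 - 1)) ^ F.length := by
  have h := norm_integral_trace_mul_suN_le_of_separated (d := d) (L := L) hN β F z W hW hcount hsep (fun _ => 1) 1
    continuous_const (fun _ _ _ _ => rfl) (fun _ => by simp)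
  simp only [mul_one] at h
  exact h

end ReadMany

end StrongCoupling

end Summit.QuantumFields.GaugeBoot

end
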